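import Summits.PneNP.PneNP.Theorems.PositionalGamesParityMonotoneQuasipolyUpperOrder

/-!
# Progress-measure lifting: soundness
(route PneNP/PositionalGames, support item stmt-PneNP-1298 `ParityMonotoneQuasipolyUpper`)

On a dead-end-free input, a fixpoint of lifting that is finite at `v` yields a positional
strategy of Even that wins from `v` against every positional strategy of Odd, in the sense of
`ParityGame.EvenWinsPositional` (the predicate inlined by the route): Even follows a present
progressive edge; the play stays among finite vertices with all its edges progressive, and an odd
top priority `q` on the lasso cycle would make the `q`-truncations of the values decrease strictly
around the cycle (Jurdziński 2000, the "small progress measures ⇒ winning strategy" half;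
Jurdziński–Lazić 2017 §2). Main results: `evenWinsPositional_of_fixpoint`,
`evenWinsPositional_of_iter_lt_top`.
-/

namespace Summit.PneNP.PneNP.Theorems.ParityLifting

set_option linter.dupNamespace false -- `Summit.PneNP.PneNP.…`: summit = sub-problem (D-0017)

open Literature.Combinatorics.Games

variable {U : Finset (List ℕ)} {V : Type*} [Fintype V]

/-! ## Soundness: a fixpoint finite at `v` gives a positional winning strategy from `v` -/

section Sound

variable {o : V → Bool} {p : V → ℕ} {H : ℕ} {x : V × V → Bool}

/-- In a fixpoint, a finite Even vertex has a present progressive edge. -/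
theorem exists_prog_of_even {μ : V → Val U} (hfix : step o p H x μ = μ) {u : V} (hu : o u = true)
    (hlt : μ u < ⊤) : ∃ w, x (u, w) = true ∧ Prog (tl H (p u)) (decide (Odd (p u))) (μ u) (μ w) := by
  classical
  have h1 : μ u = (Finset.univ.filter fun w => x (u, w) = true).inf
      fun w => lift (tl H (p u)) (decide (Odd (p u))) (μ w) := by
    conv_lhs => rw [← hfix]
    simp [step, hu]
  have hne : (Finset.univ.filter fun w => x (u, w) = true).Nonempty := by
    by_contra hem
    rw [Finset.not_nonempty_iff_eq_empty] at hem
    rw [hem, Finset.inf_empty] at h1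
    exact (lt_top_iff_ne_top.1 hlt) h1
  obtain ⟨w, hw, heq⟩ := Finset.exists_mem_eq_inf _ hne
    (fun w => lift (tl H (p u)) (decide (Odd (p u))) (μ w))
  refine ⟨w, (Finset.mem_filter.1 hw).2, ?_⟩
  have h2 : lift (tl H (p u)) (decide (Odd (p u))) (μ w) = μ u := by rw [h1, heq]
  rw [← h2]
  exact prog_lift_of_ne_top (by rw [h2]; exact lt_top_iff_ne_top.1 hlt)

/-- In a fixpoint, every present edge out of a finite Odd vertex is progressive. -/
theorem prog_of_odd {μ : V → Val U} (hfix : step o p H x μ = μ) {u : V} (hu : o u = false)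
    (hlt : μ u < ⊤) {w : V} (hw : x (u, w) = false) :
    Prog (tl H (p u)) (decide (Odd (p u))) (μ u) (μ w) := by
  classical
  have h1 : μ u = (Finset.univ.filter fun w => x (u, w) = false).sup
      fun w => lift (tl H (p u)) (decide (Odd (p u))) (μ w) := by
    conv_lhs => rw [← hfix]
    simp [step, hu]
  have hle : lift (tl H (p u)) (decide (Odd (p u))) (μ w) ≤ μ u := by
    rw [h1]
    exact Finset.le_sup (f := fun w => lift (tl H (p u)) (decide (Odd (p u))) (μ w))
      (Finset.mem_filter.2 ⟨Finset.mem_univ _, hw⟩)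
  exact Prog.mono_left (prog_lift_of_ne_top (lt_top_iff_ne_top.1 (hle.trans_lt hlt))) hle

/-- Lower priorities see more components. -/
theorem tl_le_tl {H a b : ℕ} (h : b ≤ a) : tl H a ≤ tl H b := by
  unfold tl
  omega

/-- **Soundness of lifting.** On a dead-end-free input, a fixpoint of lifting that is finite at
`v` yields a positional strategy of Even winning from `v` against every positional strategy of
Odd: Even follows a progressive present edge; every play then stays among finite vertices with all
edges progressive, and an odd top priority `q` on the lasso cycle would make the `q`-truncations
strictly decrease around the cycle. -/
theorem evenWinsPositional_of_fixpoint (hx : ∀ u, ∃ w, x (u, w) = o u) {μ : V → Val U}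
    (hfix : step o p H x μ = μ) {v : V} (hv : μ v < ⊤) :
    ParityGame.EvenWinsPositional o p (ParityGame.edgeOfBits o x) v := by
  classical
  have hEven : ∀ u, o u = true → μ u < ⊤ →
      ∃ w, x (u, w) = true ∧ Prog (tl H (p u)) (decide (Odd (p u))) (μ u) (μ w) :=
    fun u hu hlt => exists_prog_of_even hfix hu hlt
  choose σ₁ hσ₁ using hEven
  choose σ₀ hσ₀ using hx
  set σ : V → V := fun u => if h : o u = true ∧ μ u < ⊤ then σ₁ u h.1 h.2 else σ₀ u with hσ
  refine ⟨σ, fun u hu => ?_, fun τ hτ => ?_⟩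
  · show x (u, σ u) = o u
    simp only [hσ]
    split_ifs with h
    · rw [(hσ₁ u h.1 h.2).1, hu]
    · exact hσ₀ u
  · set f := positionalPlay o σ τ with hf
    have hstep : ∀ u, μ u < ⊤ →
        μ (f u) < ⊤ ∧ Prog (tl H (p u)) (decide (Odd (p u))) (μ u) (μ (f u)) := by
      intro u hlt
      by_cases hu : o u = true
      · have hfu : f u = σ₁ u hu hlt := by
          rw [hf, positionalPlay_of_eq_true _ _ hu]
          simp [hσ, hu, hlt]
        rw [hfu]
        exact ⟨Prog.lt_top (hσ₁ u hu hlt).2 hlt, (hσ₁ u hu hlt).2⟩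
      · rw [Bool.not_eq_true] at hu
        have hfu : f u = τ u := by rw [hf, positionalPlay_of_eq_false _ _ hu]
        have hxw : x (u, τ u) = false := by
          have h := hτ u hu
          simp only [ParityGame.edgeOfBits, hu] at h
          exact h
        rw [hfu]
        exact ⟨Prog.lt_top (prog_of_odd hfix hu hlt hxw) hlt, prog_of_odd hfix hu hlt hxw⟩
    have horbit : ∀ t, μ (f^[t] v) < ⊤ := by
      intro t
      induction t with
      | zero => exact hv
      | succ t ih =>
        rw [Function.iterate_succ_apply']
        exact (hstep _ ih).1
    set C := lassoCycle o σ τ v with hC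
    obtain ⟨u₀, hu₀C, hq⟩ := Finset.exists_mem_eq_sup C (lassoCycle_nonempty o σ τ v) p
    rw [hq]
    by_contra hodd
    rw [Nat.not_even_iff_odd] at hodd
    have hmemC : ∀ u ∈ C, μ u < ⊤ := by
      intro u hu
      rw [hC, mem_lassoCycle] at hu
      obtain ⟨t, ht⟩ := hu.exists
      rw [← ht]
      exact horbit t
    set i := tl H (p u₀) with hi
    have hdec : ∀ u ∈ C, trunc i (μ (f u)) ≤ trunc i (μ u) := by
      intro u hu
      have hpu : p u ≤ p u₀ := hq ▸ Finset.le_sup (f := p) hu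
      exact trunc_le_trunc_of_le (tl_le_tl hpu) (Prog.le (hstep u (hmemC u hu)).2)
    have hstrict : trunc i (μ (f u₀)) < trunc i (μ u₀) := by
      have h := (hstep u₀ (hmemC u₀ hu₀C)).2
      rw [decide_eq_true hodd] at h
      exact prog_true.1 h
    have hmem_iter : ∀ j, f^[j] u₀ ∈ C := by
      intro j
      induction j with
      | zero => exact hu₀C
      | succ j ih =>
        rw [Function.iterate_succ_apply']
        exact positionalPlay_mem_lassoCycle ih
    have hiter : ∀ j, trunc i (μ (f^[j + 1] u₀)) ≤ trunc i (μ (f u₀)) := by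
      intro j
      induction j with
      | zero => exact le_rfl
      | succ j ih =>
        calc trunc i (μ (f^[j + 1 + 1] u₀)) = trunc i (μ (f (f^[j + 1] u₀))) := by
              rw [Function.iterate_succ_apply']
          _ ≤ trunc i (μ (f^[j + 1] u₀)) := hdec _ (hmem_iter _)
          _ ≤ _ := ih
    obtain ⟨m, hm⟩ : ∃ m, f^[m + 1] u₀ = u₀ := by
      have hfr := hu₀C
      rw [hC, mem_lassoCycle] at hfr
      obtain ⟨t₁, ht₁⟩ := hfr.exists
      obtain ⟨t₂, ht₂, ht₂'⟩ := (Filter.frequently_atTop.1 hfr) (t₁ + 1)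
      refine ⟨t₂ - t₁ - 1, ?_⟩
      have h12 : t₂ - t₁ - 1 + 1 + t₁ = t₂ := by omega
      calc f^[t₂ - t₁ - 1 + 1] u₀ = f^[t₂ - t₁ - 1 + 1] (f^[t₁] v) := by rw [ht₁]
        _ = f^[t₂ - t₁ - 1 + 1 + t₁] v := (Function.iterate_add_apply f _ _ v).symm
        _ = u₀ := by rw [h12, ht₂']
    have h := hiter m
    rw [hm] at h
    exact absurd (h.trans_lt hstrict) (lt_irrefl _)

/-- **Soundness for the iteration**: on a dead-end-free input, if the stable iterate is finite at
`v` then Even wins positionally from `v`. -/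
theorem evenWinsPositional_of_iter_lt_top (hx : ∀ u, ∃ w, x (u, w) = o u) {v : V}
    (hv : iter (U := U) o p H x (Fintype.card V * Fintype.card (Val U)) v < ⊤) :
    ParityGame.EvenWinsPositional o p (ParityGame.edgeOfBits o x) v :=
  evenWinsPositional_of_fixpoint hx ((iter_succ o p H x _).symm.trans (iter_stable o p H x)) hv

end Sound

end Summit.PneNP.PneNP.Theorems.ParityLifting
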